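import Literature.NumberTheory.Transcendental.PreBlochRigidity
import Literature.NumberTheory.Transcendental.PreBlochUniqueDivisibility
import HarnessLib

/-!
# The endomorphism `{z}/3` of `P(F)` and the absence of `3`-torsion (Dupont Thm. 8.16, `n = 3`)

Seventh step towards the named fact
`Literature.NumberTheory.Transcendental.Suslin1991_preBloch_isUniquelyDivisible`
(`PreBlochGroup.lean`; Dupont, *Scissors congruences, group homology and characteristic classes*
(2001), **Thm. 8.16**: `𝒫_F` is uniquely divisible for `F` algebraically closed of characteristic
`0`). After `PreBlochUniqueDivisibility.lean` the residual claim is the injectivity of `p • (·)` for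
the odd primes `p`, i.e. (Dupont p. 43, Suslin ICM 1986 Thm. 6.3) that
`{z}/p := ∑_{ξ^p = 1} [ξ z^{1/p}]` respects the five-term relation:

  `Ψ(u, v, w) = ∑_ξ [ξu] - ∑_ξ [ξv] + ∑_ξ [ξ v/u] - ∑_ξ [ξ wv/u] + ∑_ξ [ξw] = 0`
  whenever `(1 - v^p) w^p = 1 - u^p` (`u^p = z₁`, `v^p = z₂`).

Suslin proves this by rigidity of specializations along the curves `w = const` of the surface
`S_p : (1 - v^p) w^p = 1 - u^p` (his Prop. 6.2, which rests on the `K₃`-transfer). Here the case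
**`p = 3`** is settled WITHOUT `K`-theory: `S₃` is (an affine piece of) the Fermat cubic surface
`u³ + w³ - (vw)³ = 1`, a rational surface, and every point of it lies on a line or on a conic of
`S₃` meeting the line `L₀ = {u = v = 1}` (the residual conic of the plane through `L₀` and the
point: `w (1 - v) = μ (u - 1)`). Along such a rational curve `Ψ̃` is constant by
`PreBloch.root_packets_rigidity` (Rogers' identity), and on `L₀` it vanishes
(`∑_ξ ⟦ξ⟧ = ⟦ζ⟧ + ⟦ζ⁻¹⟧ = 0`). Concretely, with `μ = w(1-v)/(u-1)`, `b² = -1/μ`,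
`k₀ = (w - b)/(u - 1)` and the parameter `k = k₀ + t`:

  `u(t) = 1 + s`, `w(t) = b + k s`, `v(t) = 1 - μ s / w(t)`, `s = -lin(k)/quad(k)`,
  `lin(k) = 3 - 3μ²b + 6μbk`, `quad(k) = 1 + μ³ - 3μ²k + 3μk²`,

passes through `(u, v, w)` at `t = 0` and through `(1, 1, -b) ∈ L₀` at `t = ∞`; the degenerate case
`quad(k₀) = 0` only happens when `μ³ = -1`, which is avoided by re-choosing the cube root `v` of
`z₂` (`exists_good_cube_root`).

## Contents

* `PreBloch.thirdSym z = {z}/3 = ∑_{r³ = z} ⟦r⟧` (sum over the multiset of cube roots),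
  `thirdSym_eq`, `three_nsmul_thirdSym` (`3 · {z}/3 = {z}`, the distribution relation);
* the algebra of the residual conic: `conicLin`, `conicQuad`, `conicQ`, `S3_factor`,
  `conicQ_expand`, `conic_key`, `lin_quad_degenerate`;
* **`root_packets_eq_zero`**: Suslin's `Ψ(u, v, w) = 0` on `S₃` (under `μ³ ≠ -1`);
* **`thirdSym_five_term`**: `{z}/3` respects the five-term relation;
* the endomorphism `PreBloch.third : P(F) →+ P(F)` with `3 • third a = a`, hence
  **`three_nsmul_injective`**, `three_nsmul_bijective`, and the sharpened reduction
  `isUniquelyDivisible_of_prime_injective_of_five_le`: unique divisibility of `P(F)` follows from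
  the injectivity of `p • (·)` for the primes `p ≥ 5` (for which `S_p` is of general type and the
  present method provably cannot work; that part remains Suslin's theorem and is NOT proved here).

## References

* J. L. Dupont, *Scissors congruences, group homology and characteristic classes*, World
  Scientific 2001: Thm. 8.16 and its sketch proof, p. 43. [Dupont2001]
* A. A. Suslin, *Algebraic K-theory of fields*, Proc. ICM Berkeley 1986, vol. 1, 222–244: §6,
  Prop. 6.2, Thm. 6.3 (the displayed relation for `[x] ↦ ∑_{y^p = x} [y]`). [Suslin1986]
-/

noncomputable section

namespace Literature.NumberTheory.Transcendental

namespace PreBloch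

variable {F : Type*} [Field F]

open Polynomial

/-! ### Cube roots and the symbol `{z}/3` -/

/-- A chosen cube root in an algebraically closed field. [folklore] -/
def cbrt [IsAlgClosed F] (z : F) : F :=
  Classical.choose (IsAlgClosed.exists_pow_nat_eq z (by norm_num : 0 < 3))

/-- `(cbrt z)³ = z`. [folklore] -/
theorem cbrt_cube [IsAlgClosed F] (z : F) : cbrt z ^ 3 = z :=
  Classical.choose_spec (IsAlgClosed.exists_pow_nat_eq z (by norm_num : 0 < 3))

/-- **The symbol `{z}/3`**: the sum of the extended symbols of the cube roots of `z` (with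
multiplicity; Dupont p. 43: `{w}/n = ∑_{j<n} {ζʲ w^{1/n}}`, Suslin: `[x] ↦ ∑_{y^p = x} [y]`).
[cite: Dupont2001, p. 43] -/
def thirdSym (z : F) : PreBloch F :=
  ((Polynomial.nthRoots 3 z).map sym).sum

/-- `{z}/3 = ∑_{j<3} ⟦ζʲ r⟧` for any cube root `r` of `z` and any primitive cube root of unity `ζ`.
[cite: Dupont2001, p. 43] -/
theorem thirdSym_eq {ζ : F} (hζ : IsPrimitiveRoot ζ 3) {z r : F} (hr : r ^ 3 = z) :
    thirdSym z = ∑ j ∈ Finset.range 3, sym (ζ ^ j * r) := by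
  unfold thirdSym
  rw [hζ.nthRoots_eq hr, Multiset.map_map, Finset.sum_eq_multiset_sum, Finset.range_val]
  rfl

/-- `3 · {z}/3 = ⟦z⟧` (the distribution relation, Dupont Cor. 8.15 for `n = 3`).
[cite: Dupont2001, Cor. 8.15] -/
theorem three_nsmul_thirdSym [IsAlgClosed F] [CharZero F] (z : F) : (3 : ℕ) • thirdSym z = sym z := by
  obtain ⟨ζ, hζ⟩ := exists_isPrimitiveRoot (F := F) (n := 3) (by norm_num)
  rw [thirdSym_eq hζ (cbrt_cube z), ← distribution' (by norm_num) hζ (cbrt z), cbrt_cube]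

/-! ### Algebra of the residual conic of `S₃` in the plane `w (1 - v) = μ (u - 1)` -/

section Conic

variable {R : Type*} [CommRing R]

/-- `lin(k) = 3 - 3μ²b + 6μbk`: the coefficient of `s` in `conicQ μ (1+s) (b+ks)`. [folklore] -/
def conicLin (μ b k : R) : R := 3 - 3 * μ ^ 2 * b + 6 * μ * b * k

/-- `quad(k) = 1 + μ³ - 3μ²k + 3μk²`: the coefficient of `s²` in `conicQ μ (1+s) (b+ks)`. [folklore] -/
def conicQuad (μ k : R) : R := 1 + μ ^ 3 - 3 * μ ^ 2 * k + 3 * μ * k ^ 2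

/-- The residual conic `q(u, w) = u² + u + 1 + μ³(u-1)² - 3μ²(u-1)w + 3μw²` of the plane section
`w(1 - v) = μ(u - 1)` of `S₃` (the section is `L₀ + conic`, `L₀ = {u = 1}`). [folklore] -/
def conicQ (μ u w : R) : R :=
  u ^ 2 + u + 1 + μ ^ 3 * (u - 1) ^ 2 - 3 * μ ^ 2 * (u - 1) * w + 3 * μ * w ^ 2

/-- On the plane `vw = w - μ(u-1)` the equation of `S₃` factors as `(u - 1) · q(u, w)`:
`w³ - (w - μ(u-1))³ - (1 - u³) = (u - 1) q(u, w)`. [folklore] -/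
theorem S3_factor (μ u w : R) :
    w ^ 3 - (w - μ * (u - 1)) ^ 3 - (1 - u ^ 3) = (u - 1) * conicQ μ u w := by
  unfold conicQ
  ring

/-- Expansion of the conic along the lines through the base point `(1, b)`:
`q(1 + s, b + ks) = 3(1 + μb²) + lin(k) s + quad(k) s²`. [folklore] -/
theorem conicQ_expand (μ b k s : R) :
    conicQ μ (1 + s) (b + k * s) = 3 * (1 + μ * b ^ 2) + conicLin μ b k * s + conicQuad μ k * s ^ 2 := by
  unfold conicQ conicLin conicQuad
  ring

/-- **The parametrised conic lies on `S₃`** (polynomial form): with `ℓ = lin(k)`, `q = quad(k)`,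
`D = bq - kℓ` and `μb² = -1`, `D³ - (D + μℓ)³ = q³ - (q - ℓ)³`
(both sides differ by `-3ℓq²(1 + μb²)`). [folklore] -/
theorem conic_key (μ b k : R) (h : μ * b ^ 2 = -1) :
    (b * conicQuad μ k - k * conicLin μ b k) ^ 3 -
        (b * conicQuad μ k - k * conicLin μ b k + μ * conicLin μ b k) ^ 3 =
      conicQuad μ k ^ 3 - (conicQuad μ k - conicLin μ b k) ^ 3 := by
  unfold conicQuad conicLin
  linear_combination (-3 * (3 - 3 * μ ^ 2 * b + 6 * μ * b * k) *
    (1 + μ ^ 3 - 3 * μ ^ 2 * k + 3 * μ * k ^ 2) ^ 2) * h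

/-- The degenerate case: `lin(k) = quad(k) = 0` and `μb² = -1` force `3μ(1 + μ³) = 0`
(`quad` at the root of `lin` equals `(1 + μ³)/4`). [folklore] -/
theorem lin_quad_degenerate {μ b k : R} (hl : conicLin μ b k = 0) (hq : conicQuad μ k = 0)
    (h : μ * b ^ 2 = -1) : 3 * (μ * (1 + μ ^ 3)) = 0 := by
  unfold conicLin at hl
  unfold conicQuad at hq
  linear_combination (μ * (3 - 3 * μ ^ 2 * b + 6 * μ * b * k) - 6 * μ) * hl +
    (-12 * μ ^ 2 * b ^ 2) * hq + (12 * μ + 3 * μ ^ 4) * h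

/-- Transport of the key identity to the rational functions: `D³ - A³ = q³ - B³` gives
`(1 - (A/D)³)(D/q)³ = 1 - (B/q)³`. [folklore] -/
theorem conic_transport {K : Type*} [Field K] {A B D q : K} (hD : D ≠ 0) (hq : q ≠ 0)
    (key : D ^ 3 - A ^ 3 = q ^ 3 - B ^ 3) : (1 - (A / D) ^ 3) * (D / q) ^ 3 = 1 - (B / q) ^ 3 := by
  rw [div_pow, div_pow, div_pow, one_sub_div (pow_ne_zero 3 hD), one_sub_div (pow_ne_zero 3 hq),
    div_mul_div_comm, key, mul_comm (D ^ 3) (q ^ 3), mul_div_mul_right _ _ (pow_ne_zero 3 hD)]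

end Conic

/-- Not all three values `(1 - ζᵇ v)³` (`b = 0, 1, 2`) coincide for `v ≠ 0` and `ζ` a primitive cube
root of unity; in the form used below: some `(c (1 - ζᵇ v))³ ≠ -1`. [folklore] -/
theorem exists_good_cube_root [CharZero F] {ζ : F} (hζ : IsPrimitiveRoot ζ 3) {v c : F}
    (hv : v ≠ 0) (hc : c ≠ 0) : ∃ b ∈ Finset.range 3, (c * (1 - ζ ^ b * v)) ^ 3 ≠ -1 := by
  by_contra H
  push Not at H
  have h0 := H 0 (by simp)
  have h1 := H 1 (by simp)
  have h2 := H 2 (by simp)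
  rw [pow_zero, one_mul, mul_pow] at h0
  rw [pow_one, mul_pow] at h1
  rw [mul_pow] at h2
  have hc3 : c ^ 3 ≠ 0 := pow_ne_zero 3 hc
  have A : (1 - v) ^ 3 = (1 - ζ * v) ^ 3 := mul_left_cancel₀ hc3 (h0.trans h1.symm)
  have B : (1 - ζ * v) ^ 3 = (1 - ζ ^ 2 * v) ^ 3 := mul_left_cancel₀ hc3 (h1.trans h2.symm)
  have hζ3 : ζ ^ 3 = 1 := hζ.pow_eq_one
  have hζ1 : ζ ≠ 1 := hζ.ne_one (by norm_num)
  have hζ0 : ζ ≠ 0 := hζ.ne_zero (by norm_num)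
  have h3 : (3 : F) ≠ 0 := by norm_num
  have h1ζ : (1 : F) - ζ ≠ 0 := sub_ne_zero.2 (Ne.symm hζ1)
  have A' : 3 * v * (1 - ζ) * (v * (1 + ζ) - 1) = 0 := by
    linear_combination A - v ^ 3 * hζ3
  have B' : 3 * ζ * v * (1 - ζ) * (ζ * v * (1 + ζ) - 1) = 0 := by
    linear_combination B - v ^ 3 * ζ ^ 3 * hζ3
  have e1 : v * (1 + ζ) - 1 = 0 :=
    (mul_eq_zero.1 A').resolve_left (mul_ne_zero (mul_ne_zero h3 hv) h1ζ)
  have e2 : ζ * v * (1 + ζ) - 1 = 0 :=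
    (mul_eq_zero.1 B').resolve_left (mul_ne_zero (mul_ne_zero (mul_ne_zero h3 hζ0) hv) h1ζ)
  apply hζ1
  linear_combination e2 - ζ * e1

/-! ### Bookkeeping on quadratic polynomials -/

/-- `deg (a + bX + cX²) ≤ 2`. [folklore] -/
theorem natDegree_quadratic_le (a b c : F) : (C a + C b * X + C c * X ^ 2).natDegree ≤ 2 := by
  compute_degree

/-- The coefficient of `X²` in `a + bX + cX²`. [folklore] -/
theorem coeff_quadratic_two (a b c : F) : (C a + C b * X + C c * X ^ 2).coeff 2 = c := by
  simp

/-- The value at `0` of `a + bX + cX²`. [folklore] -/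
theorem eval_quadratic_zero (a b c : F) : (C a + C b * X + C c * X ^ 2).eval 0 = a := by
  simp

/-- The image of `a + bX + cX²` in `F(t)`. [folklore] -/
theorem algebraMap_quadratic (a b c : F) :
    algebraMap F[X] (RatFunc F) (C a + C b * X + C c * X ^ 2) =
      RatFunc.C a + RatFunc.C b * RatFunc.X + RatFunc.C c * RatFunc.X ^ 2 := by
  simp [map_add, map_mul, map_pow]

/-- A quadratic with non-zero leading coefficient is non-zero in `F(t)`. [folklore] -/
theorem algebraMap_quadratic_ne_zero {a b c : F} (hc : c ≠ 0) :
    algebraMap F[X] (RatFunc F) (C a + C b * X + C c * X ^ 2) ≠ 0 := by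
  refine RatFunc.algebraMap_ne_zero fun h => hc ?_
  have h2 := congrArg (fun p : F[X] => p.coeff 2) h
  simp only [coeff_quadratic_two, coeff_zero] at h2
  exact h2

/-- Powers at a place: `ev (xⁿ) = (ev x)ⁿ` for `x` regular. [folklore] -/
theorem IsPlace.ev_pow {K : Type*} [Field K] {Reg : K → Prop} {ev : K → F}
    (hP : IsPlace K F Reg ev) {x : K} (hx : Reg x) (n : ℕ) : Reg (x ^ n) ∧ ev (x ^ n) = ev x ^ n := by
  induction n with
  | zero => exact ⟨by rw [pow_zero]; exact hP.reg_one, by rw [pow_zero, pow_zero, hP.ev_one]⟩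
  | succ n ih =>
    refine ⟨by rw [pow_succ]; exact hP.reg_mul ih.1 hx, ?_⟩
    rw [pow_succ, pow_succ, hP.ev_mul ih.1 hx, ih.2]

/-! ### Suslin's relation on `S₃` -/

/-- **Suslin's relation `Ψ(u, v, w) = 0` on the cubic surface `(1 - v³) w³ = 1 - u³`** for `F`
algebraically closed of characteristic `0`, `ζ` a primitive cube root of unity, `u³, v³ ∉ {0, 1}`,
`u³ ≠ v³`, under the side condition `μ³ ≠ -1`, `μ = w(1-v)/(u-1)` (removable by re-choosing the
cube root `v`, see `thirdSym_five_term`):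
`∑_{j<3} (⟦ζʲu⟧ - ⟦ζʲv⟧ + ⟦ζʲ v/u⟧ - ⟦ζʲ wv/u⟧ + ⟦ζʲ w⟧) = 0`.
Proof: rigidity (`root_packets_rigidity`) along the residual conic of `S₃` in the plane
`w(1 - v) = μ(u - 1)` through the point (`t = 0`) and `(1, 1, -b) ∈ L₀` (`t = ∞`), where all
packets cancel (`∑_{j<3} ⟦ζʲ⟧ = 0`). Suslin proves this (for every prime) via Prop. 6.2.
[cite: Suslin1986, Thm. 6.3] -/
theorem root_packets_eq_zero [IsAlgClosed F] [CharZero F] {ζ : F} (hζ : IsPrimitiveRoot ζ 3)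
    {u v w : F} (hu : u ≠ 0) (hu1 : u ^ 3 ≠ 1) (hv : v ≠ 0) (hv1 : v ^ 3 ≠ 1) (huv : u ^ 3 ≠ v ^ 3)
    (hS : (1 - v ^ 3) * w ^ 3 = 1 - u ^ 3) (hμ : (w * (1 - v) / (u - 1)) ^ 3 ≠ -1) :
    ∑ j ∈ Finset.range 3, (sym (ζ ^ j * u) - sym (ζ ^ j * v) + sym (ζ ^ j * (v / u)) -
      sym (ζ ^ j * (w * v / u)) + sym (ζ ^ j * w)) = 0 := by
  have h30 : (0 : ℕ) < 3 := by norm_num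
  -- scalars
  have hu1' : u ≠ 1 := fun h => hu1 (by rw [h, one_pow])
  have hv1' : v ≠ 1 := fun h => hv1 (by rw [h, one_pow])
  have hs0 : u - 1 ≠ 0 := sub_ne_zero.2 hu1'
  have h1v : (1 : F) - v ≠ 0 := sub_ne_zero.2 (Ne.symm hv1')
  have h1u3 : (1 : F) - u ^ 3 ≠ 0 := sub_ne_zero.2 (Ne.symm hu1)
  have hw : w ≠ 0 := by
    rintro rfl
    apply h1u3
    rw [← hS]
    ring
  set μ : F := w * (1 - v) / (u - 1) with hμdef
  have hμ0 : μ ≠ 0 := div_ne_zero (mul_ne_zero hw h1v) hs0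
  have hμu : μ * (u - 1) = w * (1 - v) := by rw [hμdef, div_mul_cancel₀ _ hs0]
  set b : F := sqrt (-μ⁻¹) with hbdef
  have hb : μ * b ^ 2 = -1 := by rw [hbdef, sqrt_sq, mul_neg, mul_inv_cancel₀ hμ0]
  have hb0 : b ≠ 0 := by
    rintro h
    rw [h] at hb
    norm_num at hb
  set k₀ : F := (w - b) / (u - 1) with hk₀def
  have hk₀ : b + k₀ * (u - 1) = w := by rw [hk₀def, div_mul_cancel₀ _ hs0]; ring
  -- the point lies on the residual conic: `lin(k₀) + quad(k₀) (u - 1) = 0`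
  have hQ : conicQ μ u w = 0 := by
    have h := S3_factor μ u w
    have h' : w ^ 3 - (w - μ * (u - 1)) ^ 3 - (1 - u ^ 3) = 0 := by
      rw [hμu, ← hS]
      ring
    rw [h] at h'
    exact (mul_eq_zero.1 h').resolve_left hs0
  have hrel : conicLin μ b k₀ + conicQuad μ k₀ * (u - 1) = 0 := by
    have e := conicQ_expand μ b k₀ (u - 1)
    rw [show (1 : F) + (u - 1) = u by ring, hk₀, hQ] at e
    have : (u - 1) * (conicLin μ b k₀ + conicQuad μ k₀ * (u - 1)) = 0 := by
      linear_combination -e - 3 * hb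
    exact (mul_eq_zero.1 this).resolve_left hs0
  -- `quad(k₀) ≠ 0` (else `lin(k₀) = 0` too and `μ³ = -1`)
  have hq0 : conicQuad μ k₀ ≠ 0 := by
    intro hq
    have hl : conicLin μ b k₀ = 0 := by rwa [hq, zero_mul, add_zero] at hrel
    have h3 := lin_quad_degenerate hl hq hb
    have h3' : (3 : F) ≠ 0 := by norm_num
    have h13 : 1 + μ ^ 3 = 0 := (mul_eq_zero.1 ((mul_eq_zero.1 h3).resolve_left h3')).resolve_left hμ0
    apply hμ
    linear_combination h13
  -- the scalars of the parametrisation `k = k₀ + t`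
  set ℓ₀ : F := conicLin μ b k₀ with hℓ₀
  set ℓ₁ : F := 6 * μ * b with hℓ₁
  set q₀ : F := conicQuad μ k₀ with hq₀def
  set q₁ : F := 6 * μ * k₀ - 3 * μ ^ 2 with hq₁
  set q₂ : F := 3 * μ with hq₂
  have hq2 : q₂ ≠ 0 := mul_ne_zero (by norm_num) hμ0
  have hc2 : b * q₂ - ℓ₁ ≠ 0 := by
    rw [hq₂, hℓ₁, show b * (3 * μ) - 6 * μ * b = -(3 * (μ * b)) by ring, neg_ne_zero]
    exact mul_ne_zero (by norm_num) (mul_ne_zero hμ0 hb0)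
  have hℓq : ℓ₀ = -(q₀ * (u - 1)) := by linear_combination hrel
  -- the polynomials (numerators and denominators, all of degree ≤ 2)
  set Qp : F[X] := C q₀ + C q₁ * X + C q₂ * X ^ 2 with hQp
  set Nu : F[X] := C (q₀ - ℓ₀) + C (q₁ - ℓ₁) * X + C q₂ * X ^ 2 with hNu
  set Nw : F[X] := C (b * q₀ - k₀ * ℓ₀) + C (b * q₁ - k₀ * ℓ₁ - ℓ₀) * X + C (b * q₂ - ℓ₁) * X ^ 2 with hNw
  set Nv : F[X] := C (b * q₀ - k₀ * ℓ₀ + μ * ℓ₀) + C (b * q₁ - k₀ * ℓ₁ - ℓ₀ + μ * ℓ₁) * X +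
    C (b * q₂ - ℓ₁) * X ^ 2 with hNv
  have aQ : algebraMap F[X] (RatFunc F) Qp ≠ 0 := algebraMap_quadratic_ne_zero hq2
  have aNw : algebraMap F[X] (RatFunc F) Nw ≠ 0 := algebraMap_quadratic_ne_zero hc2
  -- the rational curve
  set uu : RatFunc F := algebraMap F[X] (RatFunc F) Nu / algebraMap F[X] (RatFunc F) Qp with huudef
  set ww : RatFunc F := algebraMap F[X] (RatFunc F) Nw / algebraMap F[X] (RatFunc F) Qp with hwwdef
  set vv : RatFunc F := algebraMap F[X] (RatFunc F) Nv / algebraMap F[X] (RatFunc F) Nw with hvvdef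
  -- it lies on `S₃`
  have hbK : RatFunc.C μ * RatFunc.C b ^ 2 = (-1 : RatFunc F) := by
    rw [← map_pow, ← map_mul, hb, map_neg, map_one]
  have key := conic_key (RatFunc.C μ) (RatFunc.C b) (RatFunc.C k₀ + RatFunc.X) hbK
  have imL : ∀ x y z : F, RatFunc.C (conicLin x y z) = conicLin (RatFunc.C x) (RatFunc.C y) (RatFunc.C z) := by
    intro x y z
    unfold conicLin
    simp only [map_add, map_sub, map_mul, map_pow, map_ofNat]
  have imQd : ∀ x z : F, RatFunc.C (conicQuad x z) = conicQuad (RatFunc.C x) (RatFunc.C z) := by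
    intro x z
    unfold conicQuad
    simp only [map_add, map_sub, map_mul, map_pow, map_ofNat, map_one]
  have eQ : algebraMap F[X] (RatFunc F) Qp = conicQuad (RatFunc.C μ) (RatFunc.C k₀ + RatFunc.X) := by
    rw [hQp, algebraMap_quadratic, hq₀def, hq₁, hq₂]
    simp only [map_sub, map_mul, map_pow, map_ofNat, imQd]
    unfold conicQuad
    ring
  have eNu : algebraMap F[X] (RatFunc F) Nu = conicQuad (RatFunc.C μ) (RatFunc.C k₀ + RatFunc.X) -
      conicLin (RatFunc.C μ) (RatFunc.C b) (RatFunc.C k₀ + RatFunc.X) := by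
    rw [hNu, algebraMap_quadratic, hq₀def, hq₁, hq₂, hℓ₀, hℓ₁]
    simp only [map_sub, map_mul, map_pow, map_ofNat, imQd, imL]
    unfold conicQuad conicLin
    ring
  have eNw : algebraMap F[X] (RatFunc F) Nw =
      RatFunc.C b * conicQuad (RatFunc.C μ) (RatFunc.C k₀ + RatFunc.X) -
        (RatFunc.C k₀ + RatFunc.X) * conicLin (RatFunc.C μ) (RatFunc.C b) (RatFunc.C k₀ + RatFunc.X) := by
    rw [hNw, algebraMap_quadratic, hq₀def, hq₁, hq₂, hℓ₀, hℓ₁]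
    simp only [map_sub, map_mul, map_pow, map_ofNat, imQd, imL]
    unfold conicQuad conicLin
    ring
  have eNv : algebraMap F[X] (RatFunc F) Nv =
      RatFunc.C b * conicQuad (RatFunc.C μ) (RatFunc.C k₀ + RatFunc.X) -
        (RatFunc.C k₀ + RatFunc.X) * conicLin (RatFunc.C μ) (RatFunc.C b) (RatFunc.C k₀ + RatFunc.X) +
        RatFunc.C μ * conicLin (RatFunc.C μ) (RatFunc.C b) (RatFunc.C k₀ + RatFunc.X) := by
    rw [hNv, algebraMap_quadratic, hq₀def, hq₁, hq₂, hℓ₀, hℓ₁]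
    simp only [map_sub, map_add, map_mul, map_pow, map_ofNat, imQd, imL]
    unfold conicQuad conicLin
    ring
  have hS' : (1 - vv ^ 3) * ww ^ 3 = 1 - uu ^ 3 := by
    have hD : RatFunc.C b * conicQuad (RatFunc.C μ) (RatFunc.C k₀ + RatFunc.X) -
        (RatFunc.C k₀ + RatFunc.X) * conicLin (RatFunc.C μ) (RatFunc.C b) (RatFunc.C k₀ + RatFunc.X) ≠ 0 := by
      rw [← eNw]; exact aNw
    have hq : conicQuad (RatFunc.C μ) (RatFunc.C k₀ + RatFunc.X) ≠ 0 := by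
      rw [← eQ]; exact aQ
    rw [huudef, hvvdef, hwwdef, eQ, eNu, eNw, eNv]
    exact conic_transport hD hq key
  -- values at `t = 0`
  have vQ : Qp.eval 0 = q₀ := by rw [hQp, eval_quadratic_zero]
  have vNu : Nu.eval 0 = q₀ * u := by rw [hNu, eval_quadratic_zero, hℓq]; ring
  have vNw : Nw.eval 0 = q₀ * w := by
    rw [hNw, eval_quadratic_zero, hℓq]
    linear_combination q₀ * hk₀
  have vNv : Nv.eval 0 = q₀ * w * v := by
    rw [hNv, eval_quadratic_zero, hℓq]
    linear_combination q₀ * hk₀ - q₀ * hμu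
  have r_u : reg0 uu ∧ ev0 uu = u := by
    rw [huudef]
    obtain ⟨hr, he⟩ := reg0_div (F := F) (p := Nu) (q := Qp) (by rw [vQ]; exact hq0)
    exact ⟨hr, by rw [he, vNu, vQ, mul_div_cancel_left₀ _ hq0]⟩
  have r_w : reg0 ww ∧ ev0 ww = w := by
    rw [hwwdef]
    obtain ⟨hr, he⟩ := reg0_div (F := F) (p := Nw) (q := Qp) (by rw [vQ]; exact hq0)
    exact ⟨hr, by rw [he, vNw, vQ, mul_div_cancel_left₀ _ hq0]⟩
  have r_v : reg0 vv ∧ ev0 vv = v := by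
    rw [hvvdef]
    obtain ⟨hr, he⟩ := reg0_div (F := F) (p := Nv) (q := Nw) (by rw [vNw]; exact mul_ne_zero hq0 hw)
    exact ⟨hr, by rw [he, vNv, vNw, mul_div_cancel_left₀ _ (mul_ne_zero hq0 hw)]⟩
  -- values at `t = ∞`
  have i_u : regInf uu ∧ evInf uu = 1 := by
    rw [huudef]
    obtain ⟨hr, he⟩ := regInf_evInf_div (F := F) (N := 2) (p := Nu) (q := Qp)
      (by rw [hNu]; exact natDegree_quadratic_le _ _ _) (by rw [hQp]; exact natDegree_quadratic_le _ _ _)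
      (by rw [hQp, coeff_quadratic_two]; exact hq2)
    exact ⟨hr, by rw [he, hNu, hQp, coeff_quadratic_two, coeff_quadratic_two, div_self hq2]⟩
  have i_w : regInf ww ∧ evInf ww = -b := by
    rw [hwwdef]
    obtain ⟨hr, he⟩ := regInf_evInf_div (F := F) (N := 2) (p := Nw) (q := Qp)
      (by rw [hNw]; exact natDegree_quadratic_le _ _ _) (by rw [hQp]; exact natDegree_quadratic_le _ _ _)
      (by rw [hQp, coeff_quadratic_two]; exact hq2)
    refine ⟨hr, ?_⟩
    rw [he, hNw, hQp, coeff_quadratic_two, coeff_quadratic_two, div_eq_iff hq2, hq₂, hℓ₁]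
    ring
  have i_v : regInf vv ∧ evInf vv = 1 := by
    rw [hvvdef]
    obtain ⟨hr, he⟩ := regInf_evInf_div (F := F) (N := 2) (p := Nv) (q := Nw)
      (by rw [hNv]; exact natDegree_quadratic_le _ _ _) (by rw [hNw]; exact natDegree_quadratic_le _ _ _)
      (by rw [hNw, coeff_quadratic_two]; exact hc2)
    exact ⟨hr, by rw [he, hNv, hNw, coeff_quadratic_two, coeff_quadratic_two, div_self hc2]⟩
  -- non-degeneracy of the curve (read off at `t = 0`)
  have P0 := isPlace0 (F := F)
  have PI := isPlaceInf (F := F)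
  have huu : uu ≠ 0 := by
    intro h
    have := r_u.2
    rw [h, P0.ev_zero] at this
    exact hu this.symm
  have hvv : vv ≠ 0 := by
    intro h
    have := r_v.2
    rw [h, P0.ev_zero] at this
    exact hv this.symm
  have hww : ww ≠ 0 := by
    intro h
    have := r_w.2
    rw [h, P0.ev_zero] at this
    exact hw this.symm
  have huu3 : uu ^ 3 ≠ 1 := by
    intro h
    have e := (P0.ev_pow r_u.1 3).2
    rw [h, P0.ev_one, r_u.2] at e
    exact hu1 e.symm
  have hvv3 : vv ^ 3 ≠ 1 := by
    intro h
    have e := (P0.ev_pow r_v.1 3).2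
    rw [h, P0.ev_one, r_v.2] at e
    exact hv1 e.symm
  have huv3 : uu ^ 3 ≠ vv ^ 3 := by
    intro h
    have e := (P0.ev_pow r_u.1 3).2
    rw [h, (P0.ev_pow r_v.1 3).2, r_u.2, r_v.2] at e
    exact huv e.symm
  -- rigidity along the conic
  have R := root_packets_rigidity h30 hζ huu hvv hww huu3 hvv3 huv3 hS'
  -- the packets at `t = 0` are the packets of `(u, v, w)`
  have r_vu : reg0 (vv / uu) ∧ ev0 (vv / uu) = v / u := by
    have h := P0.reg_div r_v.1 r_u.1 (by rw [r_u.2]; exact hu)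
    rw [r_u.2, r_v.2] at h
    exact h
  have r_wvu : reg0 (ww * vv / uu) ∧ ev0 (ww * vv / uu) = w * v / u := by
    have h := P0.reg_div (P0.reg_mul r_w.1 r_v.1) r_u.1 (by rw [r_u.2]; exact hu)
    rw [P0.ev_mul r_w.1 r_v.1, r_u.2, r_v.2, r_w.2] at h
    exact h
  have L0 : ∀ j ∈ Finset.range 3,
      placeSym reg0 ev0 (RatFunc.C (ζ ^ j) * uu) - placeSym reg0 ev0 (RatFunc.C (ζ ^ j) * vv) +
        placeSym reg0 ev0 (RatFunc.C (ζ ^ j) * (vv / uu)) -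
        placeSym reg0 ev0 (RatFunc.C (ζ ^ j) * (ww * vv / uu)) + placeSym reg0 ev0 (RatFunc.C (ζ ^ j) * ww) =
      sym (ζ ^ j * u) - sym (ζ ^ j * v) + sym (ζ ^ j * (v / u)) - sym (ζ ^ j * (w * v / u)) +
        sym (ζ ^ j * w) := by
    intro j _
    rw [placeSym_C_mul P0 (reg0_ev0_C _) r_u.1, placeSym_C_mul P0 (reg0_ev0_C _) r_v.1,
      placeSym_C_mul P0 (reg0_ev0_C _) r_vu.1, placeSym_C_mul P0 (reg0_ev0_C _) r_wvu.1,
      placeSym_C_mul P0 (reg0_ev0_C _) r_w.1, r_u.2, r_v.2, r_vu.2, r_wvu.2, r_w.2]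
  -- the packets at `t = ∞` cancel
  have i_vu : regInf (vv / uu) ∧ evInf (vv / uu) = 1 := by
    have h := PI.reg_div i_v.1 i_u.1 (by rw [i_u.2]; exact one_ne_zero)
    rw [i_u.2, i_v.2, div_one] at h
    exact h
  have i_wvu : regInf (ww * vv / uu) ∧ evInf (ww * vv / uu) = -b := by
    have h := PI.reg_div (PI.reg_mul i_w.1 i_v.1) i_u.1 (by rw [i_u.2]; exact one_ne_zero)
    rw [PI.ev_mul i_w.1 i_v.1, i_u.2, i_v.2, i_w.2, mul_one, div_one] at h
    exact h
  have LI : ∀ j ∈ Finset.range 3,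
      placeSym regInf evInf (RatFunc.C (ζ ^ j) * uu) - placeSym regInf evInf (RatFunc.C (ζ ^ j) * vv) +
        placeSym regInf evInf (RatFunc.C (ζ ^ j) * (vv / uu)) -
        placeSym regInf evInf (RatFunc.C (ζ ^ j) * (ww * vv / uu)) +
        placeSym regInf evInf (RatFunc.C (ζ ^ j) * ww) = sym (ζ ^ j) := by
    intro j _
    rw [placeSym_C_mul PI (regInf_evInf_C _) i_u.1, placeSym_C_mul PI (regInf_evInf_C _) i_v.1,
      placeSym_C_mul PI (regInf_evInf_C _) i_vu.1, placeSym_C_mul PI (regInf_evInf_C _) i_wvu.1,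
      placeSym_C_mul PI (regInf_evInf_C _) i_w.1, i_u.2, i_v.2, i_vu.2, i_wvu.2, i_w.2, mul_one]
    abel
  rw [Finset.sum_congr rfl L0, Finset.sum_congr rfl LI, sum_sym_pow_primitiveRoot h30 hζ] at R
  exact R

/-! ### The five-term relation for `{z}/3` -/

/-- **`{z}/3` respects the five-term relation** (Neumann's form, as in `fiveTermRelator`): for
`x ≠ y` in `F ∖ {0, 1}`,
`{x}/3 - {y}/3 + {y/x}/3 - {(1-x⁻¹)/(1-y⁻¹)}/3 + {(1-x)/(1-y)}/3 = 0`.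
With cube roots `u³ = x`, `v³ = y`, `w³ = (1-x)/(1-y)` (so `(v/u)³ = y/x`,
`(wv/u)³ = (1-x⁻¹)/(1-y⁻¹)`) this is Suslin's `Ψ(u, v, w) = 0` (`root_packets_eq_zero`), the cube
root `v` being chosen with `μ³ ≠ -1` (`exists_good_cube_root`). Dupont p. 43: "one must prove that
… `{w}/n = ∑_j {ζʲ w^{1/n}}` is well-defined, i.e. respects the relation (8.13)"; here `n = 3`.
[cite: Dupont2001, Thm. 8.16] -/
theorem thirdSym_five_term [IsAlgClosed F] [CharZero F] {x y : F} (hx : x ≠ 0 ∧ x ≠ 1)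
    (hy : y ≠ 0 ∧ y ≠ 1) (hxy : x ≠ y) :
    thirdSym x - thirdSym y + thirdSym (y / x) - thirdSym ((1 - x⁻¹) / (1 - y⁻¹)) +
      thirdSym ((1 - x) / (1 - y)) = 0 := by
  obtain ⟨ζ, hζ⟩ := exists_isPrimitiveRoot (F := F) (n := 3) (by norm_num)
  -- cube roots
  set u := cbrt x with hudef
  have hu3 : u ^ 3 = x := cbrt_cube x
  set v₀ := cbrt y with hv₀def
  have hv₀3 : v₀ ^ 3 = y := cbrt_cube y
  set w := cbrt ((1 - x) / (1 - y)) with hwdef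
  have hw3 : w ^ 3 = (1 - x) / (1 - y) := cbrt_cube _
  have h1y : (1 : F) - y ≠ 0 := sub_ne_zero.2 (Ne.symm hy.2)
  have h1x : (1 : F) - x ≠ 0 := sub_ne_zero.2 (Ne.symm hx.2)
  have hu : u ≠ 0 := by rintro h; rw [h] at hu3; exact hx.1 (by rw [← hu3]; norm_num)
  have hv₀ : v₀ ≠ 0 := by rintro h; rw [h] at hv₀3; exact hy.1 (by rw [← hv₀3]; norm_num)
  have hw : w ≠ 0 := by
    rintro h
    rw [h] at hw3
    exact div_ne_zero h1x h1y (by rw [← hw3]; norm_num)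
  have hu1 : u ≠ 1 := by rintro h; rw [h, one_pow] at hu3; exact hx.2 hu3.symm
  -- choose the cube root `v = ζᵇ v₀` of `y` with `μ³ ≠ -1`
  obtain ⟨b, -, hb⟩ := exists_good_cube_root hζ hv₀ (div_ne_zero hw (sub_ne_zero.2 hu1))
  set v := ζ ^ b * v₀ with hvdef
  have hv3 : v ^ 3 = y := by
    rw [hvdef, mul_pow, ← pow_mul, mul_comm b 3, pow_mul, hζ.pow_eq_one, one_pow, one_mul, hv₀3]
  have hv : v ≠ 0 := mul_ne_zero (pow_ne_zero b (hζ.ne_zero (by norm_num))) hv₀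
  have hμ : (w * (1 - v) / (u - 1)) ^ 3 ≠ -1 := by
    rw [hvdef, show w * (1 - ζ ^ b * v₀) / (u - 1) = w / (u - 1) * (1 - ζ ^ b * v₀) by ring]
    exact hb
  have hS : (1 - v ^ 3) * w ^ 3 = 1 - u ^ 3 := by
    rw [hv3, hw3, hu3]
    field_simp
  have key := root_packets_eq_zero hζ hu (by rw [hu3]; exact hx.2) hv (by rw [hv3]; exact hy.2)
    (by rw [hu3, hv3]; exact hxy) hS hμ
  -- identify the five packets
  have e1 : thirdSym x = ∑ j ∈ Finset.range 3, sym (ζ ^ j * u) := thirdSym_eq hζ hu3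
  have e2 : thirdSym y = ∑ j ∈ Finset.range 3, sym (ζ ^ j * v) := thirdSym_eq hζ hv3
  have e3 : thirdSym (y / x) = ∑ j ∈ Finset.range 3, sym (ζ ^ j * (v / u)) :=
    thirdSym_eq hζ (by rw [div_pow, hu3, hv3])
  have e4 : thirdSym ((1 - x⁻¹) / (1 - y⁻¹)) = ∑ j ∈ Finset.range 3, sym (ζ ^ j * (w * v / u)) := by
    refine thirdSym_eq hζ ?_
    have hx1' : x - 1 ≠ 0 := sub_ne_zero.2 hx.2
    have hy1' : y - 1 ≠ 0 := sub_ne_zero.2 hy.2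
    have hx0 := hx.1
    have hy0 := hy.1
    rw [div_pow, mul_pow, hw3, hv3, hu3, one_sub_inv_eq_div hx0, one_sub_inv_eq_div hy0]
    field_simp
    ring
  have e5 : thirdSym ((1 - x) / (1 - y)) = ∑ j ∈ Finset.range 3, sym (ζ ^ j * w) := thirdSym_eq hζ hw3
  rw [e1, e2, e3, e4, e5]
  simpa only [Finset.sum_add_distrib, Finset.sum_sub_distrib] using key

end PreBloch

end Literature.NumberTheory.Transcendental

/-! ### The endomorphism `{·}/3` and the absence of 3-torsion -/

namespace Literature.NumberTheory.Transcendental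

namespace PreBloch

variable {F : Type*} [Field F]

/-- `{·}/3` on the free abelian group of generators. [cite: Dupont2001, p. 43] -/
def thirdLift : FreeAbelianGroup (Gen F) →+ PreBloch F :=
  FreeAbelianGroup.lift fun g => thirdSym g.val

/-- `{·}/3` kills the five-term relators. [cite: Dupont2001, Thm. 8.16] -/
theorem thirdLift_relator [IsAlgClosed F] [CharZero F] {r : FreeAbelianGroup (Gen F)}
    (hr : r ∈ fiveTermRelators F) : thirdLift r = 0 := by
  obtain ⟨x, y, hxy, rfl⟩ := hr
  unfold fiveTermRelator thirdLift
  simp only [map_add, map_sub, FreeAbelianGroup.lift_apply_of]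
  exact thirdSym_five_term ⟨x.val_ne_zero, x.val_ne_one⟩ ⟨y.val_ne_zero, y.val_ne_one⟩ hxy

/-- The subgroup of relations lies in the kernel of `{·}/3`. [cite: Dupont2001, Thm. 8.16] -/
theorem closure_le_ker_thirdLift [IsAlgClosed F] [CharZero F] :
    AddSubgroup.closure (fiveTermRelators F) ≤ (thirdLift (F := F)).ker :=
  (AddSubgroup.closure_le _).2 fun _ hr => thirdLift_relator hr

/-- **The endomorphism `φ₃ : P(F) → P(F)`, `[z] ↦ {z}/3 = ∑_{r³ = z} ⟦r⟧`** (well defined by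
`thirdSym_five_term`). [cite: Dupont2001, Thm. 8.16] -/
def third [IsAlgClosed F] [CharZero F] : PreBloch F →+ PreBloch F :=
  QuotientAddGroup.lift (AddSubgroup.closure (fiveTermRelators F)) thirdLift closure_le_ker_thirdLift

/-- `φ₃ [z] = {z}/3`. [cite: Dupont2001, Thm. 8.16] -/
theorem third_mk [IsAlgClosed F] [CharZero F] (z : F) (hz : z ≠ 0 ∧ z ≠ 1) :
    third (PreBloch.mk z hz) = thirdSym z := by
  show thirdLift (FreeAbelianGroup.of (⟨z, hz⟩ : Gen F)) = thirdSym z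
  unfold thirdLift
  rw [FreeAbelianGroup.lift_apply_of]
  rfl

/-- `3 φ₃ = id` on `P(F)`. [cite: Dupont2001, Thm. 8.16] -/
theorem three_nsmul_third [IsAlgClosed F] [CharZero F] (a : PreBloch F) : (3 : ℕ) • third a = a := by
  obtain ⟨w, rfl⟩ := PreBloch.proj_surjective a
  induction w using FreeAbelianGroup.induction_on with
  | zero => simp
  | of g =>
    rw [proj_of, third_mk, three_nsmul_thirdSym, sym_of_ne]
  | neg g ih => rw [map_neg, map_neg, smul_neg, ih]
  | add u v hu hv => rw [map_add, map_add, smul_add, hu, hv]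

/-- **`P(F)` has no `3`-torsion** for `F` algebraically closed of characteristic `0` (the case
`n = 3` of the uniqueness in Dupont, Thm. 8.16 / Suslin Thm. 6.3, via `φ₃`: `3a = 3b` implies
`a = φ₃(3a) = φ₃(3b) = b`). [cite: Dupont2001, Thm. 8.16] -/
theorem three_nsmul_injective [IsAlgClosed F] [CharZero F] :
    Function.Injective fun a : PreBloch F => (3 : ℕ) • a := by
  intro a b h
  simp only at h
  have ha := three_nsmul_third a
  have hb := three_nsmul_third b
  rw [← map_nsmul] at ha hb
  rw [← ha, ← hb, h]

/-- **Unique `3`-divisibility of `P(F)`** (`F` algebraically closed of characteristic `0`).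
[cite: Dupont2001, Thm. 8.16] -/
theorem three_nsmul_bijective [IsAlgClosed F] [CharZero F] :
    Function.Bijective fun a : PreBloch F => (3 : ℕ) • a :=
  ⟨three_nsmul_injective, nsmul_surjective (by norm_num)⟩

/-- **What remains of Dupont, Thm. 8.16 after `n = 2, 3`.** For `F` algebraically closed of
characteristic `0`, `P(F)` is uniquely divisible as soon as `p • (·)` is injective on `P(F)` for every
prime `p ≥ 5` (for those the splitting surface `S_p` is of general type and the rational-curve
rigidity used here cannot reach its general points; that injectivity is Suslin's theorem, ICM 1986
Thm. 6.3, proved with the `K₃`-transfer, and is not formalized). [cite: Dupont2001, Thm. 8.16] -/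
theorem isUniquelyDivisible_of_prime_injective_of_five_le [IsAlgClosed F] [CharZero F]
    (h : ∀ p : ℕ, p.Prime → 5 ≤ p → Function.Injective fun a : PreBloch F => p • a) :
    IsUniquelyDivisible (PreBloch F) := by
  refine isUniquelyDivisible_of_odd_prime_injective fun p hp hp2 => ?_
  by_cases hp3 : p = 3
  · subst hp3
    exact three_nsmul_injective
  · exact h p hp (hp.five_le_of_ne_two_of_ne_three hp2 hp3)

end PreBloch

end Literature.NumberTheory.Transcendental
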